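import Summits.AnomalousDissipation.AnomalousDissipation.Theorems.SolenoidalFractalHomogenisationLagrangianStepVmodBridge
import Summits.AnomalousDissipation.AnomalousDissipation.Theorems.SolenoidalFractalHomogenisationLagrangianStepVmodLinkForcing
import Summits.AnomalousDissipation.AnomalousDissipation.Theorems.SolenoidalFractalHomogenisationLagrangianStepVmodFlatBlocks
import HarnessLib

/-!
# K1L_D (stmt-AnomalousDissipation-27980): (V_mod) flat stage, block (ss) — ENERGY AT THE PROPAGATOR LEVEL and THE FAST CONTENT OF A
# CLASS-PAIR ORBIT (sideband slaving + one-step fast decay; tools L-sb / fast kill of the certifier's table, row «C / coarse / y ≥ 1»)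
(helper; `--supports 27980 --as helper`; prover ad-sawtooth-k1loc-p1 g15; on top of `…VmodBridge` (propagator ↔ `CellChain.modeRep`),
w1's `CellChain.fastEnergy_le` (prover ad-k1l-cellLawV-w1 g5) and the class-pair tools of `…VmodLinkForcing`.)

Cell units of `VmodFlat.SSMode_textE(H)`: `U` the propagator of the cell problem (carrier `W₁.cell n`, tensor `(1/n²)•𝔸`, `NearIso 𝔸 lo hi`, `lo > 0`)
on `[0,T₀]`, a window start `s` at carrier phase 0.
* §1 **`exists_sol_modeRep_energy`** — the bridge of `…VmodBridge` together with w1's energy representative: a Lions solution `u` and `E, Q` with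
  `𝓕(U s (s+τ) y)(k) = modeRep … k τ` and **`‖U s (s+τ) y‖² ≤ E τ`** for EVERY `τ ∈ [0, T₀ − s]` (finite Parseval sums of the continuous representatives
  are below the continuous `E` a.e., hence everywhere; then `hasSum_le_of_sum_le`), plus the conjuncts of `exists_energyRep_cell` consumed below.
* §2 **`sqrt_fast_le`** — for a weakly divergence-free `y ∈ V2` carried by the class pair of a slow label `ℓ` (`ℓ ≠ 0`, `2|ℓ| < n`), at every
  `t ∈ [s, T₀]`:  `√(‖U s t y‖² − ‖𝓕(U s t y)(ℓ)‖² − ‖𝓕(U s t y)(−ℓ)‖²) ≤ (8ξΣⱼ‖αⱼ‖/(π·lo))·‖y‖ + exp(−π²·lo·(t−s)/2)·√(‖y‖² − ‖𝓕y(ℓ)‖² − ‖𝓕y(−ℓ)‖²)`,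
  `ξ = √|ℓ|²/n` — the fast (sideband) content of the orbit is slaved to the datum in bulk (`2A/dmin`, gap `dmin = 2π²lo` by class-pair confinement)
  up to the exponentially killed fast content of the datum (`CellChain.fastEnergy_le`).
`sorry`-free; NOT a proof of (ss), of the stub, of K1L_D or of AD; rung F-D1.A0.
-/

set_option linter.dupNamespace false

noncomputable section

namespace Summit.AnomalousDissipation.AnomalousDissipation.Theorems.SolenoidalFractalHomogenisation.LagrangianStep.VmodGen

open Set MeasureTheory Complex UnitAddTorus
open scoped InnerProductSpace ENNReal
open Literature.Analysis Literature.Analysis.FunctionSpaces Literature.Analysis.FunctionSpaces.Torus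
open Literature.Analysis.FluidPDE Literature.Analysis.FluidPDE.Torus Literature.Analysis.FluidPDE.LatticeShear
open Summit.AnomalousDissipation.AnomalousDissipation.Theorems.SolenoidalFractalHomogenisation.LagrangianStep.CellChain
  (modeRep modeRep_zero continuousOn_modeRep linkCoeff fastEnergy_le norm_sq_le_fastEnergy exists_energyRep_cell
   norm_latticeVec_ge_of_classPair_ne)
open Summit.AnomalousDissipation.AnomalousDissipation.Theorems.SolenoidalFractalHomogenisation.LagrangianStep.Sideband
  (slotAmp slotAmp_def conj_slotAmp norm_linkCoeff_le_sqrt pair_neighbours_not_mem ae_classPair_of_ne_zero_cell sum_norm_sq_le_fastEnergy)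
open Summit.AnomalousDissipation.AnomalousDissipation.Theorems.SolenoidalFractalHomogenisation.LagrangianStep.VmodFlat (fc)

variable {k₀ : ℕ}

/-! ## §1 The bridge with the energy representative -/

/-- **PROPAGATOR ↔ MODE REPRESENTATIVES, WITH ENERGY.**  As `exists_sol_forall_fcoeff_eq_modeRep`, for a datum `y ∈ V2` (weakly divergence free),
together with w1's energy representative `E, Q` of the Lions solution and the everywhere bound `‖U s (s+τ) y‖² ≤ E τ` on `[0, T₀ − s]`.
[cite: LionsMagenes1972, Chap. 3 Thm. 1.1] [cite: Temam1984, Ch. III §1 Lemma 1.2] -/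
theorem exists_sol_modeRep_energy (W₁ : LatticeWord k₀) (n : ℕ) {T₀ : ℝ} {𝔹 : Visc4 (Fin 3)} {lo' hi' : ℝ}
    (h𝔹 : NearIso 𝔹 lo' hi') (hlo' : 0 < lo')
    {U : ℝ → ℝ → (V2 →L[ℝ] V2)} (hU : IsPropagator T₀ (W₁.cell n) 𝔹 U)
    {s : ℝ} (hs : 0 ≤ s) (hsT : s < T₀) (hphase : ∀ τ, W₁.cell n (s + τ) = W₁.cell n τ)
    (y : V2) (hy : FunctionSpaces.Torus.IsWeaklyDivFree (y : VF)) :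
    ∃ u : ℝ → UnitAddTorus (Fin 3) → EuclideanSpace ℝ (Fin 3), ∃ E Q : ℝ → ℝ,
      IsWeakTensorPassiveVectorOn 0 (T₀ - s) 𝔹 (W₁.cell n) (y : VF) u ∧
      (∀ τ ∈ Icc 0 (T₀ - s), ∀ k : Fin 3 → ℤ, fc (U s (s + τ) y) k = modeRep W₁ n 𝔹 (y : VF) u k τ) ∧
      E 0 = ‖y‖ ^ 2 ∧ ContinuousOn E (Icc 0 (T₀ - s)) ∧ AntitoneOn E (Icc 0 (T₀ - s)) ∧
      (∀ a ∈ Icc 0 (T₀ - s), ∀ b' ∈ Icc 0 (T₀ - s), AbsolutelyContinuousOnInterval E a b') ∧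
      (∀ᵐ t ∂(volume.restrict (Ioo 0 (T₀ - s))), E t = ∫ x, ‖u t x‖ ^ 2) ∧
      (∀ᵐ t ∂(volume : Measure ℝ), t ∈ Ioo 0 (T₀ - s) → HasDerivAt E (-(2 * Q t)) t) ∧
      (∀ᵐ t ∂(volume.restrict (Ioo 0 (T₀ - s))), ∀ S : Finset (Fin 3 → ℤ),
        4 * Real.pi ^ 2 * ∑ k ∈ S, (⟪mFourierCoeff (EuclideanSpace.complexify ∘ u t) k,
          Torus.symbT 𝔹 k (mFourierCoeff (EuclideanSpace.complexify ∘ u t) k)⟫_ℂ).re ≤ Q t) ∧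
      (∀ τ ∈ Icc 0 (T₀ - s), ‖U s (s + τ) y‖ ^ 2 ≤ E τ) := by
  have hL0 : 0 < T₀ - s := by linarith
  have hy2 : MemLp (y : VF) 2 volume := Lp.memLp y
  have hyi : Integrable (y : VF) volume := integrable_coe_V2 y
  obtain ⟨u, hu, hUeq⟩ := exists_sol_forall_fcoeff_eq_modeRep W₁ n h𝔹 hlo' hU hs hsT hphase hy2 hy
  obtain ⟨E, Q, hE0, -, hEc, hEanti, hEac, hEae, -, -, hEd, hQdom, -⟩ := exists_energyRep_cell W₁ n hL0 h𝔹 hlo' hy2 hy hu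
  have hyeq : hy2.toLp (y : VF) = y := Lp.toLp_coeFn y hy2
  have hUeq' : ∀ τ ∈ Icc 0 (T₀ - s), ∀ k : Fin 3 → ℤ, fc (U s (s + τ) y) k = modeRep W₁ n 𝔹 (y : VF) u k τ := by
    intro τ hτ k
    have h := hUeq τ hτ k
    rw [hyeq] at h
    exact h
  refine ⟨u, E, Q, hu, hUeq', ?_, hEc, hEanti, hEac, hEae, hEd, hQdom, ?_⟩
  · rw [hE0, OneLevelSplit.norm_sq_eq_integral]
  · intro τ hτ
    -- every finite Parseval sum of the orbit is below `E τ`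
    have hfin : ∀ S : Finset (Fin 3 → ℤ), ∑ k ∈ S, ‖fc (U s (s + τ) y) k‖ ^ 2 ≤ E τ := by
      intro S
      have h1 := sum_norm_sq_le_fastEnergy W₁ n hL0 hu hyi hEc hEae ∅ S (Finset.disjoint_empty_right S) τ hτ
      rw [Finset.sum_empty, sub_zero] at h1
      refine le_trans (le_of_eq (Finset.sum_congr rfl fun k _ => ?_)) h1
      rw [hUeq' τ hτ k]
    exact hasSum_le_of_sum_le (hasSum_norm_sq_fcoeff (U s (s + τ) y)) hfin

/-! ## §2 The fast content of a class-pair orbit: sideband slaving and one-step fast decay -/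

set_option maxHeartbeats 1600000 in
/-- **THE FAST CONTENT OF A CLASS-PAIR ORBIT.**  Cell problem with `n ≠ 0` cells, tensor `(1/n²)•𝔸`, `NearIso 𝔸 lo hi`, `lo > 0`; a window start
`s` at carrier phase 0; a weakly divergence-free `y ∈ V2` whose coefficients live on the class pair of `ℓ` (`ℓ ≠ 0`, `2|ℓ| < n`).  Then at every
`t ∈ [s, T₀]`:
`√(‖U s t y‖² − ‖𝓕(U s t y)(ℓ)‖² − ‖𝓕(U s t y)(−ℓ)‖²) ≤ (8·(√|ℓ|²/n)·Σⱼ‖αⱼ‖/(π·lo))·‖y‖ + exp(−(π²·lo/2)·(t−s))·√(‖y‖² − ‖𝓕y(ℓ)‖² − ‖𝓕y(−ℓ)‖²)`.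
[cite: BedrossianCotiZelati2017, §2] [cite: Temam1984, Ch. III §1 Lemma 1.2] -/
theorem sqrt_fast_le (W₁ : LatticeWord k₀) {n : ℕ} (hn : n ≠ 0) {T₀ : ℝ} {𝔸 : Visc4 (Fin 3)} {lo hi : ℝ}
    (h𝔸 : NearIso 𝔸 lo hi) (hlo : 0 < lo)
    {U : ℝ → ℝ → (V2 →L[ℝ] V2)} (hU : IsPropagator T₀ (W₁.cell n) ((1 / (n : ℝ) ^ 2) • 𝔸) U)
    {s t : ℝ} (hs : 0 ≤ s) (hst : s ≤ t) (htT : t ≤ T₀) (hsT : s < T₀) (hphase : ∀ τ, W₁.cell n (s + τ) = W₁.cell n τ)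
    {ℓ : Fin 3 → ℤ} (hℓ0 : ℓ ≠ 0) (hℓ : 2 * Real.sqrt (freqNormSq ℓ) < n)
    (y : V2) (hy : FunctionSpaces.Torus.IsWeaklyDivFree (y : VF))
    (hys : ∀ k, fc y k ≠ 0 → (∀ i, (n : ℤ) ∣ k i - ℓ i) ∨ (∀ i, (n : ℤ) ∣ k i + ℓ i)) :
    Real.sqrt (‖U s t y‖ ^ 2 - (‖fc (U s t y) ℓ‖ ^ 2 + ‖fc (U s t y) (-ℓ)‖ ^ 2)) ≤
      (8 * (Real.sqrt (freqNormSq ℓ) / n) * (∑ j, ‖slotAmp W₁ j‖) / (Real.pi * lo)) * ‖y‖ +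
        Real.exp (-(Real.pi ^ 2 * lo / 2 * (t - s))) * Real.sqrt (‖y‖ ^ 2 - (‖fc y ℓ‖ ^ 2 + ‖fc y (-ℓ)‖ ^ 2)) := by
  classical
  set 𝔹 := (1 / (n : ℝ) ^ 2) • 𝔸 with h𝔹def
  have hnpos : 0 < n := Nat.pos_of_ne_zero hn
  have hn0 : (0 : ℝ) < n := by exact_mod_cast hnpos
  have h𝔹 : NearIso 𝔹 (1 / (n : ℝ) ^ 2 * lo) (1 / (n : ℝ) ^ 2 * hi) := h𝔸.smul (by positivity)
  have hlo' : 0 < 1 / (n : ℝ) ^ 2 * lo := by positivity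
  have hL0 : 0 < T₀ - s := by linarith
  have hyi : Integrable (y : VF) volume := integrable_coe_V2 y
  have hy2 : MemLp (y : VF) 2 volume := Lp.memLp y
  obtain ⟨u, E, Q, hu, hUeq, hE0, hEc, hEanti, hEac, hEae, hEd, hQdom, hUE⟩ :=
    exists_sol_modeRep_energy W₁ n h𝔹 hlo' hU hs hsT hphase y hy
  have hne : ℓ ≠ -ℓ := fun h' => hℓ0 (by
    funext i; have hi := congrFun h' i; simp only [Pi.neg_apply] at hi; have : ℓ i = 0 := by omega
    simpa using this)
  set W : Finset (Fin 3 → ℤ) := {ℓ, -ℓ} with hW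
  -- support of the datum (as a field) in the divisibility format
  have hys' : ∀ k, mFourierCoeff (FunctionSpaces.EuclideanSpace.complexify ∘ (y : VF)) k ≠ 0 →
      (∀ i, (n : ℤ) ∣ k i - ℓ i) ∨ (∀ i, (n : ℤ) ∣ k i + ℓ i) := hys
  -- the gap off the block
  have hℓn : 2 * ‖Torus.latticeVec ℓ‖ ≤ n := by
    have e : ‖Torus.latticeVec ℓ‖ = Real.sqrt (freqNormSq ℓ) := by
      rw [← norm_latticeVec_sq', Real.sqrt_sq (norm_nonneg _)]
    rw [e]; exact hℓ.le
  have hgap : ∀ᵐ σ ∂(volume.restrict (Ioo 0 (T₀ - s))), ∀ k : Fin 3 → ℤ, k ∉ W →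
      mFourierCoeff (EuclideanSpace.complexify ∘ u σ) k ≠ 0 → 2 * Real.pi ^ 2 * lo ≤ 8 * Real.pi ^ 2 * (1 / (n : ℝ) ^ 2 * lo) * freqNormSq k := by
    filter_upwards [ae_classPair_of_ne_zero_cell W₁ hnpos h𝔸 hlo ℓ hy2 hys' hu] with σ hσ k hkW hk
    have hmem := hσ k hk
    rw [hW, Finset.mem_insert, Finset.mem_singleton, not_or] at hkW
    have hge := norm_latticeVec_ge_of_classPair_ne hmem hkW.1 hkW.2
    have hnn : 0 ≤ (n : ℝ) - ‖Torus.latticeVec ℓ‖ := by linarith [norm_nonneg (Torus.latticeVec ℓ)]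
    have hsq : ((n : ℝ) - ‖Torus.latticeVec ℓ‖) ^ 2 ≤ freqNormSq k := by
      rw [← norm_latticeVec_sq']; exact pow_le_pow_left₀ hnn hge 2
    have h4 : (n : ℝ) ^ 2 / 4 ≤ freqNormSq k := by nlinarith [norm_nonneg (Torus.latticeVec ℓ)]
    have e : 8 * Real.pi ^ 2 * (1 / (n : ℝ) ^ 2 * lo) * freqNormSq k = 8 * Real.pi ^ 2 * lo * (freqNormSq k / (n : ℝ) ^ 2) := by
      field_simp
    rw [e]
    have h4' : 1 / 4 ≤ freqNormSq k / (n : ℝ) ^ 2 := by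
      rw [le_div_iff₀ (by positivity)]; linarith
    nlinarith [Real.pi_pos, h4', mul_pos (mul_pos (by norm_num : (0:ℝ) < 8) (pow_pos Real.pi_pos 2)) hlo]
  have hdmin : 0 < 2 * Real.pi ^ 2 * lo := by positivity
  -- the exchange amplitude: the two block modes are below `‖y‖`
  have hα : ∀ j : Fin k₀, ‖Complex.exp ((W₁.phase j).φ * Complex.I) * (1 / (2 * ((2 * Real.pi * ‖latticeVec (W₁.phase j).m‖ : ℝ) : ℂ) * Complex.I))‖ =
      ‖slotAmp W₁ j‖ := fun j => by rw [slotAmp_def]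
  have hα' : ∀ j : Fin k₀, ‖starRingEnd ℂ (Complex.exp ((W₁.phase j).φ * Complex.I)) *
      (-(1 / (2 * ((2 * Real.pi * ‖latticeVec (W₁.phase j).m‖ : ℝ) : ℂ) * Complex.I)))‖ = ‖slotAmp W₁ j‖ := fun j => by
    rw [← conj_slotAmp, Complex.norm_conj]
  have hE0nn : 0 ≤ E 0 := by rw [hE0]; positivity
  have hxE : ∀ k, ∀ σ ∈ Icc 0 (T₀ - s), ‖modeRep W₁ n 𝔹 (y : VF) u k σ‖ ≤ ‖y‖ := by
    intro k σ hσ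
    have h1 := norm_sq_le_fastEnergy W₁ n hL0 hu hyi hEc hEae ∅ (Finset.notMem_empty k) σ hσ
    rw [Finset.sum_empty, sub_zero] at h1
    have h2 : E σ ≤ E 0 := hEanti ⟨le_rfl, hL0.le⟩ hσ hσ.1
    rw [hE0] at h2
    exact (pow_le_pow_iff_left₀ (norm_nonneg _) (norm_nonneg y) two_ne_zero).1 (h1.trans h2)
  set ξ := Real.sqrt (freqNormSq ℓ) / n with hξ
  have hξ0 : 0 ≤ ξ := by positivity
  set A : ℝ := 2 * (‖y‖ * ∑ j : Fin k₀, 2 * Real.pi * ξ * (‖slotAmp W₁ j‖ + ‖slotAmp W₁ j‖)) with hA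
  have hlinkW : ∀ k ∈ W, ∀ j σ, ‖linkCoeff W₁ n k j σ‖ ≤ 2 * Real.pi * ξ := by
    intro k hk j σ
    rw [hW, Finset.mem_insert, Finset.mem_singleton] at hk
    rcases hk with rfl | rfl
    · exact norm_linkCoeff_le_sqrt W₁ n _ j σ
    · have h1 := norm_linkCoeff_le_sqrt W₁ n (-ℓ) j σ; rwa [freqNormSq_neg] at h1
  have hAb : ∀ σ ∈ Icc 0 (T₀ - s), ∑ k ∈ W, (‖modeRep W₁ n 𝔹 (y : VF) u k σ‖ * ∑ j, ‖linkCoeff W₁ n k j σ‖ *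
      (‖Complex.exp ((W₁.phase j).φ * Complex.I) * (1 / (2 * ((2 * Real.pi * ‖latticeVec (W₁.phase j).m‖ : ℝ) : ℂ) * Complex.I))‖ +
       ‖starRingEnd ℂ (Complex.exp ((W₁.phase j).φ * Complex.I)) *
          (-(1 / (2 * ((2 * Real.pi * ‖latticeVec (W₁.phase j).m‖ : ℝ) : ℂ) * Complex.I)))‖)) ≤ A := by
    intro σ hσ
    have hterm : ∀ k ∈ W, ‖modeRep W₁ n 𝔹 (y : VF) u k σ‖ * ∑ j, ‖linkCoeff W₁ n k j σ‖ *
        (‖Complex.exp ((W₁.phase j).φ * Complex.I) * (1 / (2 * ((2 * Real.pi * ‖latticeVec (W₁.phase j).m‖ : ℝ) : ℂ) * Complex.I))‖ +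
         ‖starRingEnd ℂ (Complex.exp ((W₁.phase j).φ * Complex.I)) *
            (-(1 / (2 * ((2 * Real.pi * ‖latticeVec (W₁.phase j).m‖ : ℝ) : ℂ) * Complex.I)))‖) ≤
        ‖y‖ * ∑ j : Fin k₀, 2 * Real.pi * ξ * (‖slotAmp W₁ j‖ + ‖slotAmp W₁ j‖) := by
      intro k hk
      refine mul_le_mul (hxE k σ hσ) (Finset.sum_le_sum fun j _ => ?_) (Finset.sum_nonneg fun j _ => by positivity) (norm_nonneg _)
      rw [hα j, hα' j]
      exact mul_le_mul_of_nonneg_right (hlinkW k hk j σ) (by positivity)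
    calc _ ≤ ∑ _k ∈ W, ‖y‖ * ∑ j : Fin k₀, 2 * Real.pi * ξ * (‖slotAmp W₁ j‖ + ‖slotAmp W₁ j‖) := Finset.sum_le_sum hterm
      _ = A := by rw [Finset.sum_const, show W.card = 2 by rw [hW]; exact Finset.card_pair hne, two_nsmul, hA]; ring
  have hA0 : 0 ≤ A := by rw [hA]; exact mul_nonneg zero_le_two (mul_nonneg (norm_nonneg _) (Finset.sum_nonneg fun j _ => by positivity))
  -- w1's fast-energy bound on the window `[0, t − s]`
  have hτ : t - s ∈ Icc 0 (T₀ - s) := ⟨by linarith, by linarith⟩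
  have key := fastEnergy_le W₁ n hL0.le h𝔹 hu hyi hEae hQdom hEd hEac W hdmin hgap (pair_neighbours_not_mem W₁ hn hℓ) hAb hτ
  -- identify the block sums at `0` and at `t − s` with the propagator's coefficients
  have hsumW : ∀ σ ∈ Icc 0 (T₀ - s), ∑ k ∈ W, ‖modeRep W₁ n 𝔹 (y : VF) u k σ‖ ^ 2 =
      ‖fc (U s (s + σ) y) ℓ‖ ^ 2 + ‖fc (U s (s + σ) y) (-ℓ)‖ ^ 2 := by
    intro σ hσ
    rw [hW, Finset.sum_pair hne, ← hUeq σ hσ ℓ, ← hUeq σ hσ (-ℓ)]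
  have h0mem : (0:ℝ) ∈ Icc 0 (T₀ - s) := ⟨le_rfl, hL0.le⟩
  have hU0 : U s (s + 0) y = y := by rw [add_zero]; exact hU.self_of_divFree s hs hsT.le y hy
  have est : s + (t - s) = t := by ring
  have hZt : ‖U s t y‖ ^ 2 - (‖fc (U s t y) ℓ‖ ^ 2 + ‖fc (U s t y) (-ℓ)‖ ^ 2) ≤
      E (t - s) - ∑ k ∈ W, ‖modeRep W₁ n 𝔹 (y : VF) u k (t - s)‖ ^ 2 := by
    have h := hUE (t - s) hτ
    rw [hsumW (t - s) hτ, est]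
    rw [est] at h
    linarith
  have hZ0 : E 0 - ∑ k ∈ W, ‖modeRep W₁ n 𝔹 (y : VF) u k 0‖ ^ 2 = ‖y‖ ^ 2 - (‖fc y ℓ‖ ^ 2 + ‖fc y (-ℓ)‖ ^ 2) := by
    rw [hsumW 0 h0mem, hU0, hE0]
  rw [hZ0] at key
  -- nonnegativity of the two fast contents (Bessel)
  have hbessel : ∀ z : V2, ‖fc z ℓ‖ ^ 2 + ‖fc z (-ℓ)‖ ^ 2 ≤ ‖z‖ ^ 2 := by
    intro z
    have h := sum_le_hasSum W (fun k _ => sq_nonneg ‖fc z k‖) (hasSum_norm_sq_fcoeff z)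
    rw [hW, Finset.sum_pair hne] at h
    exact h
  have hZ0nn : 0 ≤ ‖y‖ ^ 2 - (‖fc y ℓ‖ ^ 2 + ‖fc y (-ℓ)‖ ^ 2) := by linarith [hbessel y]
  -- `Z(t) ≤ 4A²/d² + e^{−dτ/2} Z(0)`, then square roots
  have hexp0 : 0 ≤ Real.exp (-(2 * Real.pi ^ 2 * lo / 2 * (t - s))) := (Real.exp_pos _).le
  have hZt' : ‖U s t y‖ ^ 2 - (‖fc (U s t y) ℓ‖ ^ 2 + ‖fc (U s t y) (-ℓ)‖ ^ 2) ≤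
      4 * A ^ 2 / (2 * Real.pi ^ 2 * lo) ^ 2 + Real.exp (-(2 * Real.pi ^ 2 * lo / 2 * (t - s))) * (‖y‖ ^ 2 - (‖fc y ℓ‖ ^ 2 + ‖fc y (-ℓ)‖ ^ 2)) := by
    have h1 := hZt.trans key
    have h2 : 0 ≤ Real.exp (-(2 * Real.pi ^ 2 * lo / 2 * (t - s))) * (4 * A ^ 2 / (2 * Real.pi ^ 2 * lo) ^ 2) := by positivity
    linarith
  have hsq1 : Real.sqrt (4 * A ^ 2 / (2 * Real.pi ^ 2 * lo) ^ 2) = 2 * A / (2 * Real.pi ^ 2 * lo) := by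
    rw [show 4 * A ^ 2 / (2 * Real.pi ^ 2 * lo) ^ 2 = (2 * A / (2 * Real.pi ^ 2 * lo)) ^ 2 by field_simp; ring,
      Real.sqrt_sq (by positivity)]
  have hsq2 : Real.sqrt (Real.exp (-(2 * Real.pi ^ 2 * lo / 2 * (t - s))) * (‖y‖ ^ 2 - (‖fc y ℓ‖ ^ 2 + ‖fc y (-ℓ)‖ ^ 2))) =
      Real.exp (-(Real.pi ^ 2 * lo / 2 * (t - s))) * Real.sqrt (‖y‖ ^ 2 - (‖fc y ℓ‖ ^ 2 + ‖fc y (-ℓ)‖ ^ 2)) := by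
    rw [Real.sqrt_mul hexp0]
    congr 1
    have e2 : Real.exp (-(2 * Real.pi ^ 2 * lo / 2 * (t - s))) = Real.exp (-(Real.pi ^ 2 * lo / 2 * (t - s))) ^ 2 := by
      rw [← Real.exp_nat_mul]; congr 1; push_cast; ring
    rw [e2, Real.sqrt_sq (Real.exp_pos _).le]
  have hsqrt_add : ∀ {a b : ℝ}, 0 ≤ a → 0 ≤ b → Real.sqrt (a + b) ≤ Real.sqrt a + Real.sqrt b := by
    intro a b ha hb
    rw [← Real.sqrt_sq (add_nonneg (Real.sqrt_nonneg a) (Real.sqrt_nonneg b))]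
    apply Real.sqrt_le_sqrt
    nlinarith [Real.sq_sqrt ha, Real.sq_sqrt hb, Real.sqrt_nonneg a, Real.sqrt_nonneg b]
  have hmain := (Real.sqrt_le_sqrt hZt').trans (hsqrt_add (by positivity) (mul_nonneg hexp0 hZ0nn))
  rw [hsq1, hsq2] at hmain
  refine hmain.trans (le_of_eq ?_)
  -- bookkeeping of the constant `2A/dmin = (8ξΣ‖α‖/(π lo))·‖y‖`
  have hS : ∑ j : Fin k₀, 2 * Real.pi * ξ * (‖slotAmp W₁ j‖ + ‖slotAmp W₁ j‖) = 4 * Real.pi * ξ * ∑ j, ‖slotAmp W₁ j‖ := by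
    rw [Finset.mul_sum]; exact Finset.sum_congr rfl fun j _ => by ring
  rw [hA, hS, hξ]
  have hpi : Real.pi ≠ 0 := Real.pi_pos.ne'
  field_simp
  ring

end Summit.AnomalousDissipation.AnomalousDissipation.Theorems.SolenoidalFractalHomogenisation.LagrangianStep.VmodGen

end
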